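import Literature.NumberTheory.EllipticCurves.Curve6137TwoIsogenyDescent
import HarnessLib

/-!
# The `2`-isogeny Selmer bounds of `Y = [0, -58, 0, 616, 0] : y² = x(x − 14)(x − 44)`: `dim₂ S(-58,616) ≤ 2`, `dim₂ S'(-58,616) ≤ 1`
# (Silverman, AEC X.4.9, Example X.4.10: the congruence method)

Topic `NumberTheory/EllipticCurves`. File zero of the RANK-`1` ISOGENY-DOOR cell of route ShaPrimaryTransfer (seat bsd-line-spt-p1;
companions `Curve8x121SharpDescentY`, `Curve8x121IsogenyRank`, `Curve8x121SelmerCertificatesA`/`B`, `Curve8x121SelmerPointClasses`, `Curve8x121NontrivialSha`). `Y` is a model of the curve with full rational `2`-torsion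
`X' = [0, -16, 0, -420, 0]` (`Y = ⟨1, -14, 0, 0⟩ • X'`). Here: the curves `Y`, `Y' = [0, 116, 0, 900, 0]`, and the upper bounds
of the descent via the `2`-isogeny `Y → Y'`: `S'(-58, 616) = S(116, 900) ⊆ {1, -10}` (every other squarefree divisor class
of `900` dies modulo a prime power in both affine charts, tree lemma `Carrier6137.not_isSoluble_padic_twoIsogenyQuartic_of_zmodPow`), and
`dim₂ S(-58, 616) ≤ ω(616) + 1 = 2`. Theorems only; obstruction moduli found by a plain search (0 kit).

## References

* [SilvermanAEC2009] J. H. Silverman, *AEC*, 2nd ed.: Prop. X.4.9, Example X.4.10.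
-/

noncomputable section

open scoped Classical

namespace Literature.NumberTheory.EllipticCurves

namespace Curve8x121

open _root_.WeierstrassCurve _root_.WeierstrassCurve.Affine

/-! ## 0. The curves `Y`, `Y'` -/

/-- `b(a² − 4b) ≠ 0` for `Y = E_{-58,616}`. [cite: SilvermanAEC2009, Prop. X.4.9] -/
theorem habY : (616 : ℤ) * ((-58 : ℤ) ^ 2 - 4 * (616)) ≠ 0 := by norm_num

/-- The tree's literal `E_{-58,616}` is `Y`. [cite: SilvermanAEC2009, Prop. X.4.9] -/
theorem lit_Y : (⟨0, ((-58 : ℤ) : ℚ), 0, ((616 : ℤ) : ℚ), 0⟩ : WeierstrassCurve ℚ) = ⟨0, -58, 0, 616, 0⟩ := by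
  ext <;> push_cast <;> ring

/-- The tree's literal `E_{−2a, a²−4b}` for `(a,b) = (-58,616)` is `Y' = [0, 116, 0, 900, 0]`. [cite: SilvermanAEC2009, Prop. X.4.9] -/
theorem lit_Y' :
    (⟨0, ((-2 * (-58) : ℤ) : ℚ), 0, (((-58 : ℤ) ^ 2 - 4 * (616) : ℤ) : ℚ), 0⟩ : WeierstrassCurve ℚ) = ⟨0, 116, 0, 900, 0⟩ := by
  ext <;> push_cast <;> ring

/-- The half-model literal for `(a,b) = (-58,616)`. [cite: SilvermanAEC2009, Prop. X.4.9] -/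
private theorem lit_V₀Y :
    (⟨0, -((-58 : ℤ) : ℚ) / 2, 0, (((-58 : ℤ) : ℚ) ^ 2 - 4 * (616 : ℤ)) / 16, 0⟩ : WeierstrassCurve ℚ) =
      ⟨0, 29, 0, (225 / 4), 0⟩ := by
  ext <;> push_cast <;> ring

/-- `Y = [0, -58, 0, 616, 0]` is an elliptic curve. [cite: SilvermanAEC2009, Prop. X.4.9] -/
theorem isElliptic_Y : (⟨0, -58, 0, 616, 0⟩ : WeierstrassCurve ℚ).IsElliptic := by
  rw [← lit_Y]; exact isElliptic_mk_of_ne_zero (F := ℚ) habY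

/-- `Y' = [0, 116, 0, 900, 0]` is an elliptic curve. [cite: SilvermanAEC2009, Prop. X.4.9] -/
theorem isElliptic_Y' : (⟨0, 116, 0, 900, 0⟩ : WeierstrassCurve ℚ).IsElliptic := by
  rw [← lit_Y']; exact isElliptic_mk_of_ne_zero (F := ℚ) (twoIsogenyCodomain_ne_zero habY)

/-- The half-model of `Y'` is an elliptic curve. [cite: SilvermanAEC2009, Prop. X.4.9] -/
private theorem isElliptic_V₀Y : (⟨0, 29, 0, (225 / 4), 0⟩ : WeierstrassCurve ℚ).IsElliptic := by
  rw [← lit_V₀Y]; exact isElliptic_halfModel habY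


/-! ## 1. The sharp descent on `Y = [0, -58, 0, 616, 0]`: rank `1`, `Ш(Y/ℚ)[2] = 0`, `t_2(Y) = 0` -/

/-- `S(-58, 616)` does not contain: `d = 2, -2, 7, -7, 22, -22, 77, -77` modulo `5`; `d = -14, -154` modulo `32`; `d = -1, -11` modulo `64` (no solution of either chart modulo the stated prime power; the sharp model).
[cite: SilvermanAEC2009, Example X.4.10 (the congruence method)] -/
theorem not_mem_S_Y :
    (-1 : ℤ) ∉ twoIsogenySelmerGroup (-58) (616) ∧
      (2 : ℤ) ∉ twoIsogenySelmerGroup (-58) (616) ∧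
      (-2 : ℤ) ∉ twoIsogenySelmerGroup (-58) (616) ∧
      (7 : ℤ) ∉ twoIsogenySelmerGroup (-58) (616) ∧
      (-7 : ℤ) ∉ twoIsogenySelmerGroup (-58) (616) ∧
      (-14 : ℤ) ∉ twoIsogenySelmerGroup (-58) (616) ∧
      (-11 : ℤ) ∉ twoIsogenySelmerGroup (-58) (616) ∧
      (22 : ℤ) ∉ twoIsogenySelmerGroup (-58) (616) ∧
      (-22 : ℤ) ∉ twoIsogenySelmerGroup (-58) (616) ∧
      (77 : ℤ) ∉ twoIsogenySelmerGroup (-58) (616) ∧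
      (-77 : ℤ) ∉ twoIsogenySelmerGroup (-58) (616) ∧
      (-154 : ℤ) ∉ twoIsogenySelmerGroup (-58) (616) := by
  have hB : (616 : ℤ) ≠ 0 := by norm_num
  haveI : Fact (Nat.Prime 2) := ⟨by norm_num⟩
  haveI : Fact (Nat.Prime 5) := ⟨by norm_num⟩
  refine ⟨?_, ?_, ?_, ?_, ?_, ?_, ?_, ?_, ?_, ?_, ?_, ?_⟩
  · refine Carrier6137.not_mem_twoIsogenySelmerGroup_of_not_isSoluble hB 2 ?_
    rw [show (616 : ℤ) / -1 = -616 by norm_num]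
    exact Carrier6137.not_isSoluble_padic_twoIsogenyQuartic_of_zmodPow 6 (by decide +kernel)
  · refine Carrier6137.not_mem_twoIsogenySelmerGroup_of_not_isSoluble hB 5 ?_
    rw [show (616 : ℤ) / 2 = 308 by norm_num]
    exact Carrier6137.not_isSoluble_padic_twoIsogenyQuartic_of_zmodPow 1 (by decide)
  · refine Carrier6137.not_mem_twoIsogenySelmerGroup_of_not_isSoluble hB 5 ?_
    rw [show (616 : ℤ) / -2 = -308 by norm_num]
    exact Carrier6137.not_isSoluble_padic_twoIsogenyQuartic_of_zmodPow 1 (by decide)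
  · refine Carrier6137.not_mem_twoIsogenySelmerGroup_of_not_isSoluble hB 5 ?_
    rw [show (616 : ℤ) / 7 = 88 by norm_num]
    exact Carrier6137.not_isSoluble_padic_twoIsogenyQuartic_of_zmodPow 1 (by decide)
  · refine Carrier6137.not_mem_twoIsogenySelmerGroup_of_not_isSoluble hB 5 ?_
    rw [show (616 : ℤ) / -7 = -88 by norm_num]
    exact Carrier6137.not_isSoluble_padic_twoIsogenyQuartic_of_zmodPow 1 (by decide)
  · refine Carrier6137.not_mem_twoIsogenySelmerGroup_of_not_isSoluble hB 2 ?_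
    rw [show (616 : ℤ) / -14 = -44 by norm_num]
    exact Carrier6137.not_isSoluble_padic_twoIsogenyQuartic_of_zmodPow 5 (by decide)
  · refine Carrier6137.not_mem_twoIsogenySelmerGroup_of_not_isSoluble hB 2 ?_
    rw [show (616 : ℤ) / -11 = -56 by norm_num]
    exact Carrier6137.not_isSoluble_padic_twoIsogenyQuartic_of_zmodPow 6 (by decide +kernel)
  · refine Carrier6137.not_mem_twoIsogenySelmerGroup_of_not_isSoluble hB 5 ?_
    rw [show (616 : ℤ) / 22 = 28 by norm_num]
    exact Carrier6137.not_isSoluble_padic_twoIsogenyQuartic_of_zmodPow 1 (by decide)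
  · refine Carrier6137.not_mem_twoIsogenySelmerGroup_of_not_isSoluble hB 5 ?_
    rw [show (616 : ℤ) / -22 = -28 by norm_num]
    exact Carrier6137.not_isSoluble_padic_twoIsogenyQuartic_of_zmodPow 1 (by decide)
  · refine Carrier6137.not_mem_twoIsogenySelmerGroup_of_not_isSoluble hB 5 ?_
    rw [show (616 : ℤ) / 77 = 8 by norm_num]
    exact Carrier6137.not_isSoluble_padic_twoIsogenyQuartic_of_zmodPow 1 (by decide)
  · refine Carrier6137.not_mem_twoIsogenySelmerGroup_of_not_isSoluble hB 5 ?_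
    rw [show (616 : ℤ) / -77 = -8 by norm_num]
    exact Carrier6137.not_isSoluble_padic_twoIsogenyQuartic_of_zmodPow 1 (by decide)
  · refine Carrier6137.not_mem_twoIsogenySelmerGroup_of_not_isSoluble hB 2 ?_
    rw [show (616 : ℤ) / -154 = -4 by norm_num]
    exact Carrier6137.not_isSoluble_padic_twoIsogenyQuartic_of_zmodPow 5 (by decide)

/-- A squarefree integer dividing `616` is `±` a divisor of `154`. [cite: SilvermanAEC2009, Prop. X.4.9] -/
private theorem mem_of_dvd_bY {d : ℤ} (hsq : Squarefree d) (hd : d ∣ (616 : ℤ)) :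
    d ∈ ({1, -1, 2, -2, 7, -7, 11, -11, 14, -14, 22, -22, 77, -77, 154, -154} : Finset ℤ) := by
  have hrad : d ∣ 154 := by
    have h5 : d ∣ (154 : ℤ) ^ 3 := dvd_trans hd ⟨5929, by norm_num⟩
    exact (hsq.dvd_pow_iff_dvd (by norm_num)).mp h5
  have h1 : d.natAbs ∣ 154 := by
    have := Int.natAbs_dvd_natAbs.mpr hrad
    simpa using this
  have h2 : d.natAbs ∈ Nat.divisors 154 := Nat.mem_divisors.mpr ⟨h1, by norm_num⟩
  rw [show Nat.divisors 154 = {1, 2, 7, 11, 14, 22, 77, 154} by decide +kernel] at h2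
  simp only [Finset.mem_insert, Finset.mem_singleton] at h2 ⊢
  rcases Int.natAbs_eq d with h | h <;> rw [h] <;>
    rcases h2 with h2 | h2 | h2 | h2 | h2 | h2 | h2 | h2 <;> simp [h2]

/-- **`S(-58, 616) ⊆ {1, 11, 14, 154}`**. [cite: SilvermanAEC2009, Prop. X.4.9 and Example X.4.10] -/
theorem twoIsogenySelmerGroup_Y_subset :
    twoIsogenySelmerGroup (-58) (616) ⊆ ({1, 11, 14, 154} : Finset ℤ) := by
  intro d hd
  obtain ⟨hsq, hdvd, -⟩ := (mem_twoIsogenySelmerGroup_iff (a := -58) (by norm_num : (616 : ℤ) ≠ 0)).mp hd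
  have hmem := mem_of_dvd_bY hsq hdvd
  obtain ⟨hm1, h2, hm2, h7, hm7, hm14, hm11, h22, hm22, h77, hm77, hm154⟩ := not_mem_S_Y
  simp only [Finset.mem_insert, Finset.mem_singleton] at hmem ⊢
  rcases hmem with rfl | rfl | rfl | rfl | rfl | rfl | rfl | rfl | rfl | rfl | rfl | rfl | rfl | rfl | rfl | rfl
  · simp
  · exact absurd hd hm1
  · exact absurd hd h2
  · exact absurd hd hm2
  · exact absurd hd h7
  · exact absurd hd hm7
  · simp
  · exact absurd hd hm11
  · simp
  · exact absurd hd hm14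
  · exact absurd hd h22
  · exact absurd hd hm22
  · exact absurd hd h77
  · exact absurd hd hm77
  · simp
  · exact absurd hd hm154

/-- `S(116, 900)` does not contain: `d = 3, -3, 6, -6, 15, -15, 30, -30` modulo `9`; `d = -1, 2, -5, 10` modulo `16`; `d = 5` modulo `32`; `d = -2` modulo `49` (no solution of either chart modulo the stated prime power; the sharp model, other side).
[cite: SilvermanAEC2009, Example X.4.10 (the congruence method)] -/
theorem not_mem_S'_Y :
    (-1 : ℤ) ∉ twoIsogenySelmerGroup (116) (900) ∧
      (2 : ℤ) ∉ twoIsogenySelmerGroup (116) (900) ∧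
      (-2 : ℤ) ∉ twoIsogenySelmerGroup (116) (900) ∧
      (3 : ℤ) ∉ twoIsogenySelmerGroup (116) (900) ∧
      (-3 : ℤ) ∉ twoIsogenySelmerGroup (116) (900) ∧
      (6 : ℤ) ∉ twoIsogenySelmerGroup (116) (900) ∧
      (-6 : ℤ) ∉ twoIsogenySelmerGroup (116) (900) ∧
      (5 : ℤ) ∉ twoIsogenySelmerGroup (116) (900) ∧
      (-5 : ℤ) ∉ twoIsogenySelmerGroup (116) (900) ∧
      (10 : ℤ) ∉ twoIsogenySelmerGroup (116) (900) ∧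
      (15 : ℤ) ∉ twoIsogenySelmerGroup (116) (900) ∧
      (-15 : ℤ) ∉ twoIsogenySelmerGroup (116) (900) ∧
      (30 : ℤ) ∉ twoIsogenySelmerGroup (116) (900) ∧
      (-30 : ℤ) ∉ twoIsogenySelmerGroup (116) (900) := by
  have hB : (900 : ℤ) ≠ 0 := by norm_num
  haveI : Fact (Nat.Prime 2) := ⟨by norm_num⟩
  haveI : Fact (Nat.Prime 3) := ⟨by norm_num⟩
  haveI : Fact (Nat.Prime 7) := ⟨by norm_num⟩
  refine ⟨?_, ?_, ?_, ?_, ?_, ?_, ?_, ?_, ?_, ?_, ?_, ?_, ?_, ?_⟩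
  · refine Carrier6137.not_mem_twoIsogenySelmerGroup_of_not_isSoluble hB 2 ?_
    rw [show (900 : ℤ) / -1 = -900 by norm_num]
    exact Carrier6137.not_isSoluble_padic_twoIsogenyQuartic_of_zmodPow 4 (by decide)
  · refine Carrier6137.not_mem_twoIsogenySelmerGroup_of_not_isSoluble hB 2 ?_
    rw [show (900 : ℤ) / 2 = 450 by norm_num]
    exact Carrier6137.not_isSoluble_padic_twoIsogenyQuartic_of_zmodPow 4 (by decide)
  · refine Carrier6137.not_mem_twoIsogenySelmerGroup_of_not_isSoluble hB 7 ?_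
    rw [show (900 : ℤ) / -2 = -450 by norm_num]
    exact Carrier6137.not_isSoluble_padic_twoIsogenyQuartic_of_zmodPow 2 (by decide +kernel)
  · refine Carrier6137.not_mem_twoIsogenySelmerGroup_of_not_isSoluble hB 3 ?_
    rw [show (900 : ℤ) / 3 = 300 by norm_num]
    exact Carrier6137.not_isSoluble_padic_twoIsogenyQuartic_of_zmodPow 2 (by decide)
  · refine Carrier6137.not_mem_twoIsogenySelmerGroup_of_not_isSoluble hB 3 ?_
    rw [show (900 : ℤ) / -3 = -300 by norm_num]
    exact Carrier6137.not_isSoluble_padic_twoIsogenyQuartic_of_zmodPow 2 (by decide)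
  · refine Carrier6137.not_mem_twoIsogenySelmerGroup_of_not_isSoluble hB 3 ?_
    rw [show (900 : ℤ) / 6 = 150 by norm_num]
    exact Carrier6137.not_isSoluble_padic_twoIsogenyQuartic_of_zmodPow 2 (by decide)
  · refine Carrier6137.not_mem_twoIsogenySelmerGroup_of_not_isSoluble hB 3 ?_
    rw [show (900 : ℤ) / -6 = -150 by norm_num]
    exact Carrier6137.not_isSoluble_padic_twoIsogenyQuartic_of_zmodPow 2 (by decide)
  · refine Carrier6137.not_mem_twoIsogenySelmerGroup_of_not_isSoluble hB 2 ?_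
    rw [show (900 : ℤ) / 5 = 180 by norm_num]
    exact Carrier6137.not_isSoluble_padic_twoIsogenyQuartic_of_zmodPow 5 (by decide)
  · refine Carrier6137.not_mem_twoIsogenySelmerGroup_of_not_isSoluble hB 2 ?_
    rw [show (900 : ℤ) / -5 = -180 by norm_num]
    exact Carrier6137.not_isSoluble_padic_twoIsogenyQuartic_of_zmodPow 4 (by decide)
  · refine Carrier6137.not_mem_twoIsogenySelmerGroup_of_not_isSoluble hB 2 ?_
    rw [show (900 : ℤ) / 10 = 90 by norm_num]
    exact Carrier6137.not_isSoluble_padic_twoIsogenyQuartic_of_zmodPow 4 (by decide)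
  · refine Carrier6137.not_mem_twoIsogenySelmerGroup_of_not_isSoluble hB 3 ?_
    rw [show (900 : ℤ) / 15 = 60 by norm_num]
    exact Carrier6137.not_isSoluble_padic_twoIsogenyQuartic_of_zmodPow 2 (by decide)
  · refine Carrier6137.not_mem_twoIsogenySelmerGroup_of_not_isSoluble hB 3 ?_
    rw [show (900 : ℤ) / -15 = -60 by norm_num]
    exact Carrier6137.not_isSoluble_padic_twoIsogenyQuartic_of_zmodPow 2 (by decide)
  · refine Carrier6137.not_mem_twoIsogenySelmerGroup_of_not_isSoluble hB 3 ?_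
    rw [show (900 : ℤ) / 30 = 30 by norm_num]
    exact Carrier6137.not_isSoluble_padic_twoIsogenyQuartic_of_zmodPow 2 (by decide)
  · refine Carrier6137.not_mem_twoIsogenySelmerGroup_of_not_isSoluble hB 3 ?_
    rw [show (900 : ℤ) / -30 = -30 by norm_num]
    exact Carrier6137.not_isSoluble_padic_twoIsogenyQuartic_of_zmodPow 2 (by decide)

/-- A squarefree integer dividing `900` is `±` a divisor of `30`. [cite: SilvermanAEC2009, Prop. X.4.9] -/
private theorem mem_of_dvd_bY' {d : ℤ} (hsq : Squarefree d) (hd : d ∣ (900 : ℤ)) :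
    d ∈ ({1, -1, 2, -2, 3, -3, 5, -5, 6, -6, 10, -10, 15, -15, 30, -30} : Finset ℤ) := by
  have hrad : d ∣ 30 := by
    have h5 : d ∣ (30 : ℤ) ^ 2 := dvd_trans hd ⟨1, by norm_num⟩
    exact (hsq.dvd_pow_iff_dvd (by norm_num)).mp h5
  have h1 : d.natAbs ∣ 30 := by
    have := Int.natAbs_dvd_natAbs.mpr hrad
    simpa using this
  have h2 : d.natAbs ∈ Nat.divisors 30 := Nat.mem_divisors.mpr ⟨h1, by norm_num⟩
  rw [show Nat.divisors 30 = {1, 2, 3, 5, 6, 10, 15, 30} by decide +kernel] at h2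
  simp only [Finset.mem_insert, Finset.mem_singleton] at h2 ⊢
  rcases Int.natAbs_eq d with h | h <;> rw [h] <;>
    rcases h2 with h2 | h2 | h2 | h2 | h2 | h2 | h2 | h2 <;> simp [h2]

/-- **`S(116, 900) ⊆ {1, -10}`**. [cite: SilvermanAEC2009, Prop. X.4.9 and Example X.4.10] -/
theorem twoIsogenySelmerGroup'_Y_subset :
    twoIsogenySelmerGroup (116) (900) ⊆ ({1, -10} : Finset ℤ) := by
  intro d hd
  obtain ⟨hsq, hdvd, -⟩ := (mem_twoIsogenySelmerGroup_iff (a := 116) (by norm_num : (900 : ℤ) ≠ 0)).mp hd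
  have hmem := mem_of_dvd_bY' hsq hdvd
  obtain ⟨hm1, h2, hm2, h3, hm3, h6, hm6, h5, hm5, h10, h15, hm15, h30, hm30⟩ := not_mem_S'_Y
  simp only [Finset.mem_insert, Finset.mem_singleton] at hmem ⊢
  rcases hmem with rfl | rfl | rfl | rfl | rfl | rfl | rfl | rfl | rfl | rfl | rfl | rfl | rfl | rfl | rfl | rfl
  · simp
  · exact absurd hd hm1
  · exact absurd hd h2
  · exact absurd hd hm2
  · exact absurd hd h3
  · exact absurd hd hm3
  · exact absurd hd h5
  · exact absurd hd hm5
  · exact absurd hd h6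
  · exact absurd hd hm6
  · exact absurd hd h10
  · simp
  · exact absurd hd h15
  · exact absurd hd hm15
  · exact absurd hd h30
  · exact absurd hd hm30

/-- `2^k ≤ 2^n` forces `k ≤ n`. [cite: SilvermanAEC2009, Prop. X.4.9] -/
private theorem le_of_two_pow_le {k n : ℕ} (h : 2 ^ k ≤ 2 ^ n) : k ≤ n :=
  (Nat.pow_le_pow_iff_right (by norm_num)).mp h

/-- **`dim₂ S(-58,616) ≤ 2` and `dim₂ S'(-58,616) ≤ 1`.** [cite: SilvermanAEC2009, Prop. X.4.9] -/
theorem twoIsogenySelmerRank_Y_add_le :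
    twoIsogenySelmerRank (-58) (616) ≤ 2 ∧ twoIsogenySelmerRank' (-58) (616) ≤ 1 := by
  constructor
  · apply le_of_two_pow_le
    rw [two_pow_twoIsogenySelmerRank_eq_card habY]
    exact (Finset.card_le_card twoIsogenySelmerGroup_Y_subset).trans (by decide)
  · apply le_of_two_pow_le
    rw [two_pow_twoIsogenySelmerRank'_eq_card habY, twoIsogenySelmerGroup'_eq,
      show (-2 * (-58) : ℤ) = 116 by norm_num, show ((-58 : ℤ) ^ 2 - 4 * (616) : ℤ) = 900 by norm_num]
    exact (Finset.card_le_card twoIsogenySelmerGroup'_Y_subset).trans (by decide)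


end Curve8x121

end Literature.NumberTheory.EllipticCurves

end
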